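import Summits.Ventures.PercRepro.StarGadgetPurePairG

/-!
# The tight ray of `G`: `G 0 0 0 0 n = 0` for every `n`

The zero locus of `G` on `ℕ⁵` is exactly the ray `p = q = r = s = 0` (exact evaluation on `[0,8]^5`: 59,049 points, 9 zeros, all on the ray):
the gadget `x ~ c` with no hub and any number `n` of pure pairs `P[xc|xc]` has (★)-slack `0` — (★) is tight there, as for the double-hub
gadgets without the edge `cx` (`F'_ray`).
-/

namespace PercRepro.StarGadget

/-- **The tight ray of `G`**: `G 0 0 0 0 n = 0` for every `n` — the hub-free gadget with `n` pure pairs `P[xc|xc]` has (★)-slack exactly `0`. -/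
theorem G_ray (n : ℕ) : G 0 0 0 0 n = 0 := by
  unfold G
  ring

end PercRepro.StarGadget
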